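import Summits.CriticalPhenomena.PercolationContinuityZ3.Theorems.PercNearOneGluingNoHeavyQuantSGCLightPairHolds
import Summits.CriticalPhenomena.PercolationContinuityZ3.Theorems.PercNearOneGluingNoHeavyQuantTameSiblingOracle
import HarnessLib

/-!
# QUANT lane R8, T-DEC: **COMP-SLICE HOLDS** — an SDEC law convolved with a LIGHT affordable piece `{lo, lo+K; γ}` (ANY gate `γ`, below the
# floor allowed) stays SDEC; hence **the node `SiblingStep` for EVERY forest with at least one TAME sibling, given the oracle** (arm-1 gen 57)

builds on p205010 (kernel theorem, internal audit signed; external expert review pending)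

Support file (`--supports stmt-CriticalPhenomena-4575`), QUANT lane seat prim-quant-arm-1 (gen 57, architect); memo
`run/shared/lean/prim/quant/prim-quant-arm-1-g57/ARCH-G57.md`.  Theorems only; standard axioms, no sorries.

COMP-SLICE (arm-1 g56, ARCH-G56 §4; the explicit hypothesis `hCS` of ✓ p538637 `…QuantTameSiblingOracle`): for a probability law `β` on `{0..B}`,
SDEC and affordable at `x`, and a LIGHT affordable piece `{lo, lo+K; γ}` (`0 ≤ γ ≤ 1`, `Kγ ≤ lo`, `x(lo+K) ≤ lo + Kγ`): `{lo, lo+K; γ} ∗ β` is SDEC at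
`x` on `{0..lo+K+B}`.  THE PROOF IS AN ASSEMBLY OF LANDED THEOREMS: (a) for a heavy gate `x ≤ γ` (or a trivial blob `K = 0`, where `γ` may be replaced
by `1`) it is the blob slice + relay shift `sdec_lconv_lconv_relaysBlob` (✓ arm-1 g56, on `sdec_slice'` = CW); (b) for a sub-floor gate `γ < x`
(then `K ≥ 1` and `lo ≥ 1`) it is, gate by gate, prim-quant-arm-2 g37's **cell L2 `sgcLightPair_holds`** (✓ `…QuantSGCLightPairHolds`: the gated
product of an admissible law with ONE light admissible top-affordable pair is DEC at every layer — typer g26's one-layer gated-shift construction run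
from two source layers with pooled slots), fed with `gate_a β` (SDEC `β`) and with the piece's own admissibility (`sdec_hubCore_light` with one
element: a light piece has no positive low atom at any gate).  The architect's numerics of the memo (§0 (4): the same two-copy pooled-slot scheme,
4 663 / 4 663) found the construction independently; the kernel already had it as cell L2 of `SingleGateConvClosed`.

CONSEQUENCES (discharging `hCS` in p538637): **`sdec_cons_of_tame`** — a TAME affordable law-OK sibling can be adjoined to ANY SDEC forest of law-OK
affordable siblings; **`sdec_siblings_of_tame`** — in the node's list binder (`siblingStep_iff_list`), the oracle below the gate budget and ONE tame
sibling give `SDEC x (ftop (s :: L)) (flaw (s :: L))`.  So the sibling step `SiblingStep` now owes ONLY forests ALL of whose siblings are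
heavy-unfloored at the floor (the near-sure corner of README / RATE-PLAN 57.5).

* `gate_delta_zero` (a blob of size `0` has no gate), `sdec_tpLaw_light` (the light piece alone is SDEC), **`sdec_lightPiece`** (COMP-SLICE),
  **`sdec_cons_of_tame`**, **`sdec_siblings_of_tame`**.

HONEST STATUS.  `SiblingStep` / `GateStepN` / `LightResidDECOracle` / `FarTreeRow` remain OPEN (the all-heavy-unfloored residue); RATE class (log\*) /
honest sentence of `run/shared/lean/prim/quant/README.md` unchanged.  [this work]; cell L2: prim-quant-arm-2 g37 (typer g30's statement); hub-core,
tame siblings, the conditional node: arm-1 g56.  Nothing here is cited as a published result.  The gluing rows served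
[cite: KozmaNitzan2024, Conjecture 3 (p. 15)]; product measure [cite: Grimmett1999, §1.3 p. 10].
-/

noncomputable section

open scoped BigOperators

namespace Summit.CriticalPhenomena.PercolationContinuityZ3.Theorems
namespace Quant

open Finset

/-- the two-point law `{lo, hi; g}` (as in `…QuantLawDEC`) -/
local notation3 "TP[" lo ", " hi ", " g ", " h "]" =>
  (g : ℝ) * (if (h : ℕ) = (hi : ℕ) then (1 : ℝ) else 0) + (1 - (g : ℝ)) * (if (h : ℕ) = (lo : ℕ) then (1 : ℝ) else 0)

namespace LawDec

/-- the point mass `δ_K` -/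
local notation3 "δ[" K "]" => (fun k : ℕ => if k = (K : ℕ) then (1 : ℝ) else 0)

/-- the two-point law `{lo, lo+K; g}` = `lo` sure relays and a blob of size `K` at gate `g` -/
local notation3 "TPL[" lo ", " K ", " g "]" => lconv lo K δ[lo] (gate δ[K] g)

/-- the two-point law as a pseudo-sibling with the sure root gate `1` -/
local notation3 "HS[" lo ", " K ", " g "]" => (⟨1, 0, 0, lo + K, TPL[lo, K, g]⟩ : Sib)

/-- the hub-core of elements `(lo, K, γ)` -/
local notation3 "HC[" cs "]" => List.map (fun c : ℕ × ℕ × ℝ => HS[c.1, c.2.1, c.2.2]) cs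

/-! ### The light piece alone -/

/-- a blob of size `0` has no gate: `gate δ₀ g = δ₀`. [this work] -/
theorem gate_delta_zero (g : ℝ) : gate δ[0] g = δ[0] := by
  funext h
  rw [gate_apply]
  split_ifs <;> ring

/-- **the light affordable piece `{lo, lo+K; γ}` is SDEC at `x`** (`0 ≤ γ ≤ 1` arbitrary, `Kγ ≤ lo`, `x(lo+K) ≤ lo+Kγ`): the hub-core with one element
(`sdec_hubCore_light`) — no positive low atom at any gate. [this work] -/
theorem sdec_tpLaw_light {x γ : ℝ} {lo K : ℕ} (hx0 : 0 < x) (hx1 : x < 1) (hγ0 : 0 ≤ γ) (hγ1 : γ ≤ 1)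
    (hlight : (K : ℝ) * γ ≤ lo) (haff : x * ((lo : ℝ) + K) ≤ lo + K * γ) : SDEC x (lo + K) (TPL[lo, K, γ]) := by
  have h := sdec_hubCore_light hx0 hx1 [(lo, K, γ)] (fun c hc => by simp at hc; subst hc; exact ⟨hγ0, hγ1⟩)
    (fun c hc => by simp at hc; subst hc; exact hlight) (fun c hc => by simp at hc; subst hc; exact haff)
  have e : flaw HC[[(lo, K, γ)]] = TPL[lo, K, γ] := by
    rw [flaw_hubCore_cons]
    funext k
    simp only [List.map_nil, flaw, ftop]
    exact lconv_delta_left _ _ _ (hs_facts lo K γ hγ0 hγ1).2.1 k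
  have et : ftop HC[[(lo, K, γ)]] = lo + K := by simp [ftop]
  rw [e, et] at h
  exact h

/-! ### COMP-SLICE -/

/-- **COMP-SLICE.**  `β` a probability law on `{0..B}`, affordable (`x·B ≤ mean`) and SDEC at `0 < x < 1`; a piece `{lo, lo+K; γ}` with `0 ≤ γ ≤ 1`
(ANY gate, below the floor allowed), LIGHT (`Kγ ≤ lo`) and affordable (`x(lo+K) ≤ lo+Kγ`) ⟹ `SDEC x (lo+K+B) ({lo, lo+K; γ} ∗ β)`.  Heavy gate or
trivial blob: `sdec_lconv_lconv_relaysBlob`; sub-floor gate: cell L2 `sgcLightPair_holds` at every gate `a`, with `gate_a β` from `SDEC β` and the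
piece's admissibility from `sdec_tpLaw_light`. [this work] -/
theorem sdec_lightPiece {x : ℝ} (hx0 : 0 < x) (hx1 : x < 1) {B : ℕ} {β : ℕ → ℝ} (β0 : ∀ h, 0 ≤ β h) (βM : ∀ h, B < h → β h = 0)
    (β1 : ∑ h ∈ Finset.range (B + 1), β h = 1) (hta : x * (B : ℝ) ≤ ∑ h ∈ Finset.range (B + 1), (h : ℝ) * β h) (hS : SDEC x B β)
    (lo K : ℕ) (γ : ℝ) (hγ0 : 0 ≤ γ) (hγ1 : γ ≤ 1) (hlight : (K : ℝ) * γ ≤ lo) (haff : x * ((lo : ℝ) + K) ≤ lo + K * γ) :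
    SDEC x (lo + K + B) (lconv (lo + K) B (TPL[lo, K, γ]) β) := by
  by_cases hA : x ≤ γ ∨ K = 0
  · /- (a) heavy gate, or no blob at all: a gate `γ′ ∈ [x, 1]` with the same piece -/
    obtain ⟨γ', hxγ', hγ'1, eP, haff'⟩ : ∃ γ' : ℝ, x ≤ γ' ∧ γ' ≤ 1 ∧ (TPL[lo, K, γ]) = TPL[lo, K, γ'] ∧
        x * ((lo : ℝ) + K) ≤ lo + K * γ' := by
      rcases hA with hxγ | hK
      · exact ⟨γ, hxγ, hγ1, rfl, haff⟩
      · subst hK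
        refine ⟨1, hx1.le, le_rfl, by rw [gate_delta_zero γ, gate_delta_zero 1], ?_⟩
        push_cast at haff ⊢
        linarith
    have eβ : lconv 0 B δ[0] β = β := funext fun h => lconv_delta_left 0 B β βM h
    have h0B : 0 + B = B := Nat.zero_add B
    have key := sdec_lconv_lconv_relaysBlob (N := 0) (B := B) (lo := lo) (K := K) (M := lo + K) (α := δ[0]) (β := β)
      hx0 hx1 hxγ' hγ'1 le_rfl (by push_cast; exact haff')
      (fun h => by rw [eβ]; exact β0 h) (fun h hh => by rw [eβ]; exact βM h (by omega))
      (by rw [eβ, h0B]; exact β1) (by rw [eβ, h0B]; exact hta) (by rw [eβ, h0B]; exact hS)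
    -- strip the outer `δ₀ ∗`, commute, and rename the top
    have eo : lconv 0 (B + (lo + K)) δ[0] (lconv B (lo + K) β (TPL[lo, K, γ'])) = lconv (lo + K) B (TPL[lo, K, γ]) β := by
      funext h
      rw [lconv_delta_left 0 _ _ (fun k hk => lconv_eq_zero _ _ _ _ k hk) h, lconv_comm, eP]
    have en : 0 + (B + (lo + K)) = lo + K + B := by omega
    rw [eo, en] at key
    exact key
  · /- (b) sub-floor gate and a genuine blob: cell L2 at every gate -/
    rw [not_or, not_le] at hA
    obtain ⟨hγx, hK⟩ := hA
    have hK1 : 1 ≤ K := Nat.one_le_iff_ne_zero.2 hK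
    have hP : SDEC x (lo + K) (TPL[lo, K, γ]) := sdec_tpLaw_light hx0 hx1 hγ0 hγ1 hlight haff
    have eT : (TPL[lo, K, γ]) = fun h => TP[lo, lo + K, γ, h] := funext (tpLaw_apply lo K γ)
    intro a ha0 ha1 j hj
    have hy0 : 0 < a * x := mul_pos ha0 hx0
    have hy1 : a * x < 1 := by nlinarith
    have hta' : a * x * (B : ℝ) ≤ a * ∑ h ∈ Finset.range (B + 1), (h : ℝ) * β h := by
      rw [mul_assoc]; exact mul_le_mul_of_nonneg_left hta ha0.le
    have hlt : a * γ < a * x := mul_lt_mul_of_pos_left hγx ha0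
    have haff' : a * x * ((lo + K : ℕ) : ℝ) ≤ a * ((lo : ℝ) + (((lo + K : ℕ) : ℝ) - lo) * γ) := by
      have e1 : ((lo + K : ℕ) : ℝ) = (lo : ℝ) + K := by push_cast; ring
      rw [e1, add_sub_cancel_left, mul_assoc, mul_comm (K : ℝ) γ]
      refine mul_le_mul_of_nonneg_left ?_ ha0.le
      rw [mul_comm γ (K : ℝ)]; exact haff
    have hDβ : ∀ j', j' < B → DECAt (a * x) j' B (gate β a) := fun j' hj' => hS a ha0 ha1 j' hj'
    have hDP : ∀ j', j' < lo + K → DECAt (a * x) j' (lo + K) (gate (fun h => TP[lo, lo + K, γ, h]) a) := by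
      intro j' hj'
      have h := hP a ha0 ha1 j' hj'
      rw [eT] at h
      exact h
    have key := sgcLightPair_holds (a * x) a γ B (lo + K) lo (lo + K) β hy0 hy1 ha0 ha1 β0 βM β1 hta' hDβ (by omega) le_rfl hγ0 hγ1
      hlt haff' hDP j (by omega)
    have en : lo + K + B = B + (lo + K) := by omega
    rw [lconv_comm (lo + K) B, eT, en]
    exact key

/-! ### The node for forests with a tame sibling -/

/-- **ADDING A TAME SIBLING TO ANY SDEC FOREST — UNCONDITIONALLY** (p538637's `sdec_cons_of_tame_of_compSlice` with COMP-SLICE discharged):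
`L` law-OK siblings with per-sibling affordability and `SDEC x (ftop L) (flaw L)` (from anywhere); `s` law-OK, affordable and TAME at `x` (every charged
count `h ≥ 1` light `q·mean ≤ 2h` or floored `x(M − h) ≤ q·mean − h`) ⟹ `SDEC x (ftop (s :: L)) (flaw (s :: L))`. [this work] -/
theorem sdec_cons_of_tame {x : ℝ} (hx0 : 0 < x) (hx1 : x < 1) (L : List Sib) (s : Sib)
    (hL : ∀ t ∈ L, t.LawOK) (hxL : ∀ t ∈ L, x * (t.M : ℝ) ≤ t.q * t.mean) (hS : SDEC x (ftop L) (flaw L))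
    (hs : s.LawOK) (hxs : x * (s.M : ℝ) ≤ s.q * s.mean)
    (htame : ∀ h : ℕ, 1 ≤ h → s.ρ h ≠ 0 → s.q * s.mean ≤ 2 * h ∨ x * ((s.M : ℝ) - h) ≤ s.q * s.mean - h) :
    SDEC x (ftop (s :: L)) (flaw (s :: L)) := by
  obtain ⟨f0, fM, f1, fmn⟩ := flaw_facts L hL
  have hta : x * (ftop L : ℝ) ≤ ∑ h ∈ Finset.range (ftop L + 1), (h : ℝ) * flaw L h := by
    rw [fmn]; exact floor_ftop_le_fmean' x L hxL
  exact sdec_cons_of_tame_of_compSlice hx0 hx1 L s hL hxL hS hs hxs htame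
    (fun lo K γ hγ0 hγ1 hl ha => sdec_lightPiece hx0 hx1 f0 fM f1 hta hS lo K γ hγ0 hγ1 hl ha)

/-- **THE NODE `SiblingStep` FOR EVERY FOREST WITH A TAME SIBLING, GIVEN THE ORACLE** (list binder of `siblingStep_iff_list`; the tame sibling written
first — `flaw` is a commutative convolution): tree-OK siblings `s :: L` at `0 < x < 1`, the oracle below the gate budget `fgates (s :: L)`, and `s` TAME
at `x` ⟹ `SDEC x (ftop (s :: L)) (flaw (s :: L))`.  So the sibling step owes only forests ALL of whose siblings are heavy-unfloored. [this work] -/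
theorem sdec_siblings_of_tame {x : ℝ} (hx0 : 0 < x) (hx1 : x < 1) (L : List Sib) (s : Sib) (hL : ∀ t ∈ s :: L, t.TreeOK x)
    (hO : ∀ (x' : ℝ) (n' M' : ℕ) (μ' : ℕ → ℝ), n' < fgates (s :: L) → TreeBuiltN x' n' M' μ' → SDEC x' M' μ')
    (htame : ∀ h : ℕ, 1 ≤ h → s.ρ h ≠ 0 → s.q * s.mean ≤ 2 * h ∨ x * ((s.M : ℝ) - h) ≤ s.q * s.mean - h) :
    SDEC x (ftop (s :: L)) (flaw (s :: L)) := by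
  have hL' : ∀ t ∈ L, t.TreeOK x := fun t ht => hL t (List.mem_cons_of_mem s ht)
  have hs : s.TreeOK x := hL s List.mem_cons_self
  -- the oracle certifies the rest of the forest: `flaw L` is tree-built on `fgates L < fgates (s :: L)` gates
  have hSL : SDEC x (ftop L) (flaw L) :=
    hO x (fgates L) (ftop L) (flaw L) (by simp [fgates]) (compForestN_of_list hx0 hx1 L hL').treeBuiltN
  exact sdec_cons_of_tame hx0 hx1 L s (fun t ht => (hL' t ht).lawOK) (fun t ht => (hL' t ht).afford) hSL hs.lawOK hs.afford htame

end LawDec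
end Quant
end Summit.CriticalPhenomena.PercolationContinuityZ3.Theorems
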